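/-
Origin: expansion seat `planner-pub-hodgecm-pv14-g5-0`, handover import Pv14g5.WeilThetaModelHeisenbergRelations -> HodgeCM.Automorphic.WeilThetaModelHeisenbergRelations ; import Mathlib.Analysis.SpecialFunctions.Gaussian.FourierTransform unchanged ; after WeilThetaModelHeisenbergRelations (#13, RUN 28 row 11) (`HOME/pub-hodgecm-pv14-g5/lean/Pv14g5/SchwartzGaussian.lean`, md5 e37cbc58, 419 lines);
landed by the gen-8 packager in gate run 29 as `HodgeCM/Automorphic/SchwartzGaussian.lean` (import ^import Pv14g5\.WeilThetaModelHeisenbergRelations[ \t]*$→import HodgeCM.Automorphic.WeilThetaModelHeisenbergRelations ×1).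
-/
/-
Copyright (c) 2026. All rights reserved.
Released under Apache 2.0 license as described in the file LICENSE.
-/
import Summits.HodgeConjecture.HodgeCM.Automorphic.WeilThetaModelHeisenbergRelations
import Mathlib.Analysis.SpecialFunctions.Gaussian.FourierTransform

/-!
# Gaussians `x ↦ e^{-b‖x‖²}` (`Re b > 0`) as Schwartz functions, and their role in the Weil–theta models

Mathlib (v4.32) proves the Fourier transform of the Gaussian *as a function*
(`fourier_gaussian_innerProductSpace`: `𝓕 (e^{-b‖·‖²}) = (π/b)^{d/2} e^{-π²‖·‖²/b}`) but does not
provide Gaussians as elements of the Schwartz space `𝓢(V, ℂ)`.  This file constructs them, for an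
arbitrary real inner-product space `V` and every complex "width" `b` with `0 < Re b`:

* `gaussianC V b hb : 𝓢(V, ℂ)` with `gaussianC V b hb x = exp (-b‖x‖²)` and
  `gaussian V := gaussianC V π _`, `gaussian V x = e^{-π‖x‖²}`.
  The decay estimate is the elementary recursion `D(e^q) = e^q • Dq` with `Dq = -2b⟪x, ·⟫` LINEAR,
  giving `‖Dⁿ e^{q}(x)‖ ≤ Aₙ (1 + ‖x‖)ⁿ e^{-Re b ‖x‖²}`, and `(1 + t)ᴺ e^{-r t²} ≤ e^{N²/(4r)}`.
* The family is STABLE under both generators of the models of this chain: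
  `fourier_gaussianC : 𝓕 (gaussianC b) = (π/b)^{d/2} • gaussianC (π²/b)` (finite-dimensional `V`) and
  `chirpCLM_gaussianC : T_c (gaussianC b) = gaussianC (b - 2πic)`; in particular
  `fourier_gaussian : 𝓕 (gaussian V) = gaussian V` — the Gaussian is a FIXED VECTOR of the Weyl
  element `σ ↦ 𝓕` (`repP_weyl_gaussian`), and it is even (`parityCLM_gaussian`, `P = 𝓕²`).
* `thetaH_gaussian_one`: `Θ_G(1) = ∑_{v ∈ L} e^{-π‖v‖²}` is a real number `≥ 1`, whence an EXPLICIT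
  non-degeneracy witness `θ_G(1) ≠ 0` for the models of `WeilThetaModelHeisenberg` / `…Ps` (the earlier
  `…_θ_ne_zero` theorems were existential).

The stability of `{c • gaussianC b}` under `⟨𝓕, T_c⟩` is what makes Weil's index computable ON THIS
VECTOR; the operator-level cocycle (identifying the commutant of `ρ_m(Heis V)` with the scalars) is not
addressed here — see the module docstring of `WeilThetaModelHeisenbergRelations`.
-/

noncomputable section

open scoped Real FourierTransform SchwartzMap InnerProductSpace
open Complex MeasureTheory

set_option autoImplicit false

namespace HodgeCM
namespace SchwartzWeil

/-! ## 1. An elementary polynomial-times-Gaussian bound -/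

section Elementary

/-- `(1 + t)ᴺ · e^{-r t²} ≤ e^{N² / (4r)}` for `t ≥ 0`, `r > 0`. -/
theorem one_add_pow_mul_exp_neg_mul_sq_le (N : ℕ) {r t : ℝ} (hr : 0 < r) (ht : 0 ≤ t) :
    (1 + t) ^ N * Real.exp (-r * t ^ 2) ≤ Real.exp ((N : ℝ) ^ 2 / (4 * r)) := by
  have h1 : (1 + t) ^ N ≤ Real.exp ((N : ℝ) * t) := by
    rw [Real.exp_nat_mul]
    exact pow_le_pow_left₀ (by positivity) (by linarith [Real.add_one_le_exp t]) N
  calc (1 + t) ^ N * Real.exp (-r * t ^ 2)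
      ≤ Real.exp ((N : ℝ) * t) * Real.exp (-r * t ^ 2) :=
        mul_le_mul_of_nonneg_right h1 (Real.exp_nonneg _)
    _ = Real.exp ((N : ℝ) * t + -r * t ^ 2) := (Real.exp_add _ _).symm
    _ ≤ Real.exp ((N : ℝ) ^ 2 / (4 * r)) := by
        rw [Real.exp_le_exp, le_div_iff₀ (by positivity)]
        nlinarith [sq_nonneg (2 * r * t - N)]

end Elementary

/-! ## 2. The complex Gaussians as functions, and their derivatives -/

section GaussFun

variable (V : Type*) [NormedAddCommGroup V]

/-- The Gaussian `x ↦ e^{-b‖x‖²}` of complex width `b`, as a plain function. -/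
def cgaussFun (b : ℂ) (x : V) : ℂ := Complex.exp (-b * ((‖x‖ ^ 2 : ℝ) : ℂ))

/-- (Ported verbatim from the HodgeCMPerL package; no docstring in the source.) -/
theorem cgaussFun_apply (b : ℂ) (x : V) : cgaussFun V b x = Complex.exp (-b * ((‖x‖ ^ 2 : ℝ) : ℂ)) := rfl

/-- The form matching Mathlib's `fourier_gaussian_innerProductSpace`. -/
theorem cgaussFun_apply' (b : ℂ) (x : V) : cgaussFun V b x = Complex.exp (-b * (‖x‖ : ℂ) ^ 2) := by
  rw [cgaussFun_apply]; push_cast; rfl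

/-- (Ported verbatim from the HodgeCMPerL package; no docstring in the source.) -/
theorem cgaussFun_eq (b : ℂ) : cgaussFun V b = fun x : V => Complex.exp (-b * (‖x‖ : ℂ) ^ 2) :=
  funext (cgaussFun_apply' V b)

/-- (Ported verbatim from the HodgeCMPerL package; no docstring in the source.) -/
theorem norm_cgaussFun (b : ℂ) (x : V) : ‖cgaussFun V b x‖ = Real.exp (-b.re * ‖x‖ ^ 2) := by
  rw [cgaussFun_apply, Complex.norm_exp]
  congr 1
  simp only [neg_mul, Complex.neg_re, Complex.mul_re, Complex.ofReal_re, Complex.ofReal_im, mul_zero,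
    sub_zero]

/-- (Ported verbatim from the HodgeCMPerL package; no docstring in the source.) -/
theorem cgaussFun_ne_zero (b : ℂ) (x : V) : cgaussFun V b x ≠ 0 := Complex.exp_ne_zero _

/-- (Ported verbatim from the HodgeCMPerL package; no docstring in the source.) -/
@[simp] theorem cgaussFun_zero (b : ℂ) : cgaussFun V b 0 = 1 := by simp [cgaussFun]

/-- (Ported verbatim from the HodgeCMPerL package; no docstring in the source.) -/
theorem cgaussFun_neg (b : ℂ) (x : V) : cgaussFun V b (-x) = cgaussFun V b x := by simp [cgaussFun]

/-- Real width: `e^{-r‖x‖²}` is the cast of a real exponential. -/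
theorem cgaussFun_ofReal (r : ℝ) (x : V) : cgaussFun V r x = ((Real.exp (-r * ‖x‖ ^ 2) : ℝ) : ℂ) := by
  rw [cgaussFun_apply, Complex.ofReal_exp]; push_cast; ring_nf

variable [InnerProductSpace ℝ V]

/-- `x ↦ (y ↦ ⟪x, y⟫ : ℂ)`, the inner product with complex values. -/
def innerSLC : V →L[ℝ] V →L[ℝ] ℂ :=
  (ContinuousLinearMap.compL ℝ V ℝ ℂ Complex.ofRealCLM).comp (innerSL ℝ : V →L[ℝ] V →L[ℝ] ℝ)

/-- (Ported verbatim from the HodgeCMPerL package; no docstring in the source.) -/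
@[simp] theorem innerSLC_apply (x y : V) : innerSLC V x y = ((⟪x, y⟫_ℝ : ℝ) : ℂ) := rfl

/-- The logarithmic derivative `x ↦ -2b⟪x, ·⟫` of `e^{-b‖x‖²}` — a continuous LINEAR map. -/
def cgaussLogDeriv (b : ℂ) : V →L[ℝ] V →L[ℝ] ℂ := (-(2 * b)) • innerSLC V

/-- (Ported verbatim from the HodgeCMPerL package; no docstring in the source.) -/
theorem cgaussLogDeriv_apply (b : ℂ) (x y : V) :
    cgaussLogDeriv V b x y = -(2 * b) * ((⟪x, y⟫_ℝ : ℝ) : ℂ) := rfl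

/-- (Ported verbatim from the HodgeCMPerL package; no docstring in the source.) -/
theorem contDiff_cgaussFun (b : ℂ) {n : WithTop ℕ∞} : ContDiff ℝ n (cgaussFun V b) :=
  (Complex.contDiff_exp (𝕜 := ℝ)).comp
    (contDiff_const.mul (Complex.ofRealCLM.contDiff.comp (contDiff_norm_sq ℝ)))

/-- (Ported verbatim from the HodgeCMPerL package; no docstring in the source.) -/
theorem hasFDerivAt_cgaussFun (b : ℂ) (x : V) :
    HasFDerivAt (cgaussFun V b) (cgaussFun V b x • cgaussLogDeriv V b x) x := by
  have h2 : HasFDerivAt (fun y : V => ((‖y‖ ^ 2 : ℝ) : ℂ)) (Complex.ofRealCLM.comp ((2 : ℕ) • innerSL ℝ x)) x :=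
    Complex.ofRealCLM.hasFDerivAt.comp x (hasStrictFDerivAt_norm_sq x).hasFDerivAt
  have hq : HasFDerivAt (fun y : V => -b * ((‖y‖ ^ 2 : ℝ) : ℂ))
      (-b • Complex.ofRealCLM.comp ((2 : ℕ) • innerSL ℝ x)) x := h2.const_mul (-b)
  have h : HasFDerivAt (cgaussFun V b)
      (Complex.exp (-b * ((‖x‖ ^ 2 : ℝ) : ℂ)) • (-b • Complex.ofRealCLM.comp ((2 : ℕ) • innerSL ℝ x))) x :=
    (Complex.hasDerivAt_exp _).comp_hasFDerivAt x hq
  refine h.congr_fderiv ?_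
  ext y
  rw [smul_apply, smul_apply, ContinuousLinearMap.comp_apply, smul_apply, innerSL_apply_apply, smul_apply,
    cgaussLogDeriv_apply, cgaussFun_apply, Complex.ofRealCLM_apply]
  simp only [smul_eq_mul, nsmul_eq_mul, Nat.cast_ofNat]
  push_cast
  ring

/-- (Ported verbatim from the HodgeCMPerL package; no docstring in the source.) -/
theorem fderiv_cgaussFun (b : ℂ) :
    fderiv ℝ (cgaussFun V b) = fun x => cgaussFun V b x • cgaussLogDeriv V b x :=
  funext fun x => (hasFDerivAt_cgaussFun V b x).fderiv

/-- `‖Dʲ(x ↦ L x)‖ ≤ ‖L‖ (1 + ‖x‖)` for a continuous linear map `L` and every `j`. -/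
theorem norm_iteratedFDeriv_clm_le {F : Type*} [NormedAddCommGroup F] [NormedSpace ℝ F] (L : V →L[ℝ] F)
    (j : ℕ) (x : V) : ‖iteratedFDeriv ℝ j (fun y => L y) x‖ ≤ ‖L‖ * (1 + ‖x‖) := by
  have hL1 : ‖L‖ ≤ ‖L‖ * (1 + ‖x‖) := le_mul_of_one_le_right (norm_nonneg _) (by linarith [norm_nonneg x])
  rcases j with _ | j
  · rw [norm_iteratedFDeriv_zero]
    exact (L.le_opNorm x).trans (by nlinarith [norm_nonneg L, norm_nonneg x])
  · rw [← norm_iteratedFDeriv_fderiv]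
    have hf : fderiv ℝ (fun y => L y) = fun _ => L := funext fun y => L.fderiv
    rw [hf]
    rcases j with _ | j
    · rw [norm_iteratedFDeriv_zero]; exact hL1
    · rw [iteratedFDeriv_succ_const, Pi.zero_apply, norm_zero]; positivity

/-- The derivative recursion: all derivatives of `e^{-b‖x‖²}` are bounded by
`A · (1 + ‖x‖)ⁿ · |e^{-b‖x‖²}|`, with one constant for all orders `≤ n`. -/
theorem norm_iteratedFDeriv_cgaussFun_le (b : ℂ) (n : ℕ) :
    ∃ A : ℝ, 0 ≤ A ∧ ∀ i ≤ n, ∀ x : V,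
      ‖iteratedFDeriv ℝ i (cgaussFun V b) x‖ ≤ A * (1 + ‖x‖) ^ i * ‖cgaussFun V b x‖ := by
  induction n with
  | zero =>
    refine ⟨1, zero_le_one, fun i hi x => ?_⟩
    obtain rfl : i = 0 := Nat.le_zero.mp hi
    rw [norm_iteratedFDeriv_zero]
    simp
  | succ n ih =>
    obtain ⟨A, hA, hle⟩ := ih
    refine ⟨max A (2 ^ n * A * ‖cgaussLogDeriv V b‖), le_max_of_le_left hA, fun i hi x => ?_⟩
    rcases Nat.of_le_succ hi with hi' | rfl
    · exact (hle i hi' x).trans (mul_le_mul_of_nonneg_right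
        (mul_le_mul_of_nonneg_right (le_max_left _ _) (by positivity)) (norm_nonneg _))
    -- the new order `n + 1`
    have hx1 : 1 ≤ 1 + ‖x‖ := by linarith [norm_nonneg x]
    rw [← norm_iteratedFDeriv_fderiv, fderiv_cgaussFun]
    have hprod := norm_iteratedFDeriv_smul_le (𝕜 := ℝ) (contDiff_cgaussFun V b (n := n))
      ((cgaussLogDeriv V b).contDiff (n := n)) x (n := n) le_rfl
    refine hprod.trans ?_
    have hterm : ∀ i ∈ Finset.range (n + 1),
        (n.choose i : ℝ) * ‖iteratedFDeriv ℝ i (cgaussFun V b) x‖ *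
            ‖iteratedFDeriv ℝ (n - i) (fun y => cgaussLogDeriv V b y) x‖ ≤
          (n.choose i : ℝ) *
            (A * (1 + ‖x‖) ^ n * ‖cgaussFun V b x‖ * (‖cgaussLogDeriv V b‖ * (1 + ‖x‖))) := by
      intro i hi
      have hin : i ≤ n := Nat.lt_succ_iff.mp (Finset.mem_range.mp hi)
      rw [mul_assoc]
      refine mul_le_mul_of_nonneg_left ?_ (Nat.cast_nonneg _)
      exact mul_le_mul ((hle i hin x).trans (mul_le_mul_of_nonneg_right
          (mul_le_mul_of_nonneg_left (pow_le_pow_right₀ hx1 hin) hA) (norm_nonneg _)))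
        (norm_iteratedFDeriv_clm_le V _ _ x) (norm_nonneg _)
        (mul_nonneg (mul_nonneg hA (by positivity)) (norm_nonneg _))
    refine (Finset.sum_le_sum hterm).trans ?_
    rw [← Finset.sum_mul]
    have hsum : ∑ i ∈ Finset.range (n + 1), (n.choose i : ℝ) = 2 ^ n := by
      rw [← Nat.cast_sum, Nat.sum_range_choose]; push_cast; ring
    rw [hsum]
    calc (2 : ℝ) ^ n * (A * (1 + ‖x‖) ^ n * ‖cgaussFun V b x‖ * (‖cgaussLogDeriv V b‖ * (1 + ‖x‖)))
        = 2 ^ n * A * ‖cgaussLogDeriv V b‖ * (1 + ‖x‖) ^ (n + 1) * ‖cgaussFun V b x‖ := by ring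
      _ ≤ max A (2 ^ n * A * ‖cgaussLogDeriv V b‖) * (1 + ‖x‖) ^ (n + 1) * ‖cgaussFun V b x‖ :=
        mul_le_mul_of_nonneg_right (mul_le_mul_of_nonneg_right (le_max_right _ _) (by positivity))
          (norm_nonneg _)

/-- The Schwartz decay estimate of `e^{-b‖x‖²}` for `Re b > 0`. -/
theorem decay_cgaussFun {b : ℂ} (hb : 0 < b.re) (k n : ℕ) :
    ∃ C : ℝ, ∀ x : V, ‖x‖ ^ k * ‖iteratedFDeriv ℝ n (cgaussFun V b) x‖ ≤ C := by
  obtain ⟨A, hA, hle⟩ := norm_iteratedFDeriv_cgaussFun_le V b n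
  refine ⟨A * Real.exp (((n + k : ℕ) : ℝ) ^ 2 / (4 * b.re)), fun x => ?_⟩
  calc ‖x‖ ^ k * ‖iteratedFDeriv ℝ n (cgaussFun V b) x‖
      ≤ (1 + ‖x‖) ^ k * (A * (1 + ‖x‖) ^ n * ‖cgaussFun V b x‖) :=
        mul_le_mul (pow_le_pow_left₀ (norm_nonneg _) (by linarith [norm_nonneg x]) k) (hle n le_rfl x)
          (norm_nonneg _) (by positivity)
    _ = A * ((1 + ‖x‖) ^ (n + k) * Real.exp (-b.re * ‖x‖ ^ 2)) := by rw [norm_cgaussFun]; ring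
    _ ≤ A * Real.exp (((n + k : ℕ) : ℝ) ^ 2 / (4 * b.re)) :=
        mul_le_mul_of_nonneg_left (one_add_pow_mul_exp_neg_mul_sq_le (n + k) hb (norm_nonneg x)) hA

end GaussFun

/-! ## 3. The Gaussians as Schwartz functions -/

section Schwartz

variable (V : Type*) [NormedAddCommGroup V] [InnerProductSpace ℝ V]

/-- **The Gaussian `x ↦ e^{-b‖x‖²}` (`0 < Re b`) as an element of `𝓢(V, ℂ)`.** -/
def gaussianC (b : ℂ) (hb : 0 < b.re) : 𝓢(V, ℂ) where
  toFun := cgaussFun V b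
  smooth' := contDiff_cgaussFun V b
  decay' := decay_cgaussFun V hb

variable {V} in
/-- (Ported verbatim from the HodgeCMPerL package; no docstring in the source.) -/
@[simp] theorem gaussianC_apply {b : ℂ} (hb : 0 < b.re) (x : V) :
    gaussianC V b hb x = Complex.exp (-b * (‖x‖ : ℂ) ^ 2) :=
  cgaussFun_apply' V b x

/-- (Ported verbatim from the HodgeCMPerL package; no docstring in the source.) -/
theorem coe_gaussianC {b : ℂ} (hb : 0 < b.re) :
    ⇑(gaussianC V b hb) = fun x : V => Complex.exp (-b * (‖x‖ : ℂ) ^ 2) :=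
  cgaussFun_eq V b

/-- (Ported verbatim from the HodgeCMPerL package; no docstring in the source.) -/
theorem norm_gaussianC_apply {b : ℂ} (hb : 0 < b.re) (x : V) :
    ‖gaussianC V b hb x‖ = Real.exp (-b.re * ‖x‖ ^ 2) :=
  norm_cgaussFun V b x

/-- (Ported verbatim from the HodgeCMPerL package; no docstring in the source.) -/
theorem gaussianC_ne_zero_apply {b : ℂ} (hb : 0 < b.re) (x : V) : gaussianC V b hb x ≠ 0 :=
  cgaussFun_ne_zero V b x

/-- (Ported verbatim from the HodgeCMPerL package; no docstring in the source.) -/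
theorem gaussianC_ne_zero {b : ℂ} (hb : 0 < b.re) : gaussianC V b hb ≠ 0 := fun h => by
  have := congrArg (fun Φ : 𝓢(V, ℂ) => Φ 0) h
  simp only [zero_apply] at this
  exact gaussianC_ne_zero_apply V hb 0 this

/-- The width only matters through its value: proof-irrelevant rewriting of `b`. -/
theorem gaussianC_congr {b b' : ℂ} (hb : 0 < b.re) (hb' : 0 < b'.re) (h : b = b') :
    gaussianC V b hb = gaussianC V b' hb' := by
  subst h; rfl

/-- (Ported verbatim from the HodgeCMPerL package; no docstring in the source.) -/
theorem gaussianC_neg_apply {b : ℂ} (hb : 0 < b.re) (x : V) : gaussianC V b hb (-x) = gaussianC V b hb x :=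
  cgaussFun_neg V b x

/-- Every Gaussian is even: fixed by the parity operator `P = 𝓕²`. -/
theorem parityCLM_gaussianC {b : ℂ} (hb : 0 < b.re) : parityCLM V (gaussianC V b hb) = gaussianC V b hb := by
  ext x; rw [parityCLM_apply, gaussianC_neg_apply]

/-- (Ported verbatim from the HodgeCMPerL package; no docstring in the source.) -/
theorem re_sub_chirp_pos {b : ℂ} (hb : 0 < b.re) (c : ℝ) : 0 < (b - 2 * π * c * Complex.I).re := by
  simpa using hb

/-- **Chirp stability**: the unipotent generator maps Gaussians to Gaussians,
`T_c (e^{-b‖x‖²}) = e^{-(b - 2πic)‖x‖²}`. -/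
theorem chirpCLM_gaussianC {b : ℂ} (hb : 0 < b.re) (c : ℝ) :
    chirpCLM V c (gaussianC V b hb) = gaussianC V (b - 2 * π * c * Complex.I) (re_sub_chirp_pos hb c) := by
  ext x
  rw [chirpCLM_apply, gaussianC_apply, gaussianC_apply, Real.fourierChar_apply, ← Complex.exp_add]
  congr 1
  push_cast
  ring

/-- `0 < Re π`. -/
theorem re_pi_pos : 0 < ((π : ℝ) : ℂ).re := by rw [Complex.ofReal_re]; exact Real.pi_pos

/-- **The Gaussian `x ↦ e^{-π‖x‖²}` as an element of `𝓢(V, ℂ)`.** -/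
def gaussian : 𝓢(V, ℂ) := gaussianC V π (re_pi_pos)

/-- (Ported verbatim from the HodgeCMPerL package; no docstring in the source.) -/
theorem gaussian_def : gaussian V = gaussianC V π re_pi_pos := rfl

variable {V} in
/-- (Ported verbatim from the HodgeCMPerL package; no docstring in the source.) -/
@[simp] theorem gaussian_apply (x : V) : gaussian V x = Complex.exp (-(π : ℂ) * (‖x‖ : ℂ) ^ 2) :=
  gaussianC_apply _ x

/-- (Ported verbatim from the HodgeCMPerL package; no docstring in the source.) -/
theorem coe_gaussian : ⇑(gaussian V) = fun x : V => Complex.exp (-(π : ℂ) * (‖x‖ : ℂ) ^ 2) :=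
  coe_gaussianC V _

/-- (Ported verbatim from the HodgeCMPerL package; no docstring in the source.) -/
theorem gaussian_apply_ofReal (x : V) : gaussian V x = ((Real.exp (-π * ‖x‖ ^ 2) : ℝ) : ℂ) :=
  cgaussFun_ofReal V π x

/-- (Ported verbatim from the HodgeCMPerL package; no docstring in the source.) -/
theorem norm_gaussian_apply (x : V) : ‖gaussian V x‖ = Real.exp (-π * ‖x‖ ^ 2) := by
  rw [gaussian_def, norm_gaussianC_apply, Complex.ofReal_re]

/-- (Ported verbatim from the HodgeCMPerL package; no docstring in the source.) -/
theorem gaussian_re_pos (x : V) : 0 < (gaussian V x).re := by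
  rw [gaussian_apply_ofReal, Complex.ofReal_re]; exact Real.exp_pos _

/-- (Ported verbatim from the HodgeCMPerL package; no docstring in the source.) -/
@[simp] theorem gaussian_zero : gaussian V 0 = 1 := by simp

/-- (Ported verbatim from the HodgeCMPerL package; no docstring in the source.) -/
theorem gaussian_ne_zero_apply (x : V) : gaussian V x ≠ 0 := gaussianC_ne_zero_apply V _ x

/-- (Ported verbatim from the HodgeCMPerL package; no docstring in the source.) -/
theorem gaussian_ne_zero : gaussian V ≠ 0 := gaussianC_ne_zero V _

/-- (Ported verbatim from the HodgeCMPerL package; no docstring in the source.) -/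
theorem gaussian_neg_apply (x : V) : gaussian V (-x) = gaussian V x := gaussianC_neg_apply V _ x

/-- The Gaussian is even: fixed by the parity operator `P = 𝓕²`. -/
theorem parityCLM_gaussian : parityCLM V (gaussian V) = gaussian V := parityCLM_gaussianC V _

/-- The unipotent generator on the Gaussian: `T_c G = e^{-(π - 2πic)‖x‖²}`. -/
theorem chirpCLM_gaussian (c : ℝ) :
    chirpCLM V c (gaussian V) = gaussianC V (π - 2 * π * c * Complex.I) (re_sub_chirp_pos re_pi_pos c) :=
  chirpCLM_gaussianC V _ c

end Schwartz

/-! ## 4. Fourier transforms: the Gaussian family is stable, `e^{-π‖x‖²}` is fixed -/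

section Fourier

variable (V : Type) [NormedAddCommGroup V] [InnerProductSpace ℝ V] [FiniteDimensional ℝ V]
  [MeasurableSpace V] [BorelSpace V]

/-- (Ported verbatim from the HodgeCMPerL package; no docstring in the source.) -/
theorem re_pi_sq_div_pos {b : ℂ} (hb : 0 < b.re) : 0 < ((π : ℂ) ^ 2 / b).re := by
  have hb0 : b ≠ 0 := fun h => by rw [h, Complex.zero_re] at hb; exact lt_irrefl _ hb
  rw [div_eq_mul_inv, ← Complex.ofReal_pow, Complex.re_ofReal_mul, Complex.inv_re]
  exact mul_pos (by positivity) (div_pos hb (Complex.normSq_pos.mpr hb0))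

/-- **Fourier stability**: `𝓕 (e^{-b‖·‖²}) = (π/b)^{d/2} · e^{-(π²/b)‖·‖²}` in `𝓢(V, ℂ)`. -/
theorem fourier_gaussianC {b : ℂ} (hb : 0 < b.re) :
    𝓕 (gaussianC V b hb) =
      ((π : ℂ) / b) ^ ((Module.finrank ℝ V : ℂ) / 2) • gaussianC V ((π : ℂ) ^ 2 / b) (re_pi_sq_div_pos hb) := by
  ext w
  rw [SchwartzMap.fourier_coe, coe_gaussianC, fourier_gaussian_innerProductSpace hb w, smul_apply,
    gaussianC_apply, smul_eq_mul]
  congr 2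
  ring

/-- **`𝓕 (e^{-π‖x‖²}) = e^{-π‖ξ‖²}`** in `𝓢(V, ℂ)`. -/
theorem fourier_gaussian : 𝓕 (gaussian V) = gaussian V := by
  have hπ0 : (π : ℂ) ≠ 0 := Complex.ofReal_ne_zero.mpr Real.pi_ne_zero
  rw [gaussian_def, fourier_gaussianC, div_self hπ0, Complex.one_cpow, one_smul]
  exact gaussianC_congr V _ _ (by rw [sq, mul_div_assoc, div_self hπ0, mul_one])

/-- (Ported verbatim from the HodgeCMPerL package; no docstring in the source.) -/
theorem fourierInv_gaussian : 𝓕⁻ (gaussian V) = gaussian V := by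
  conv_lhs => rw [← fourier_gaussian V]
  exact FourierTransform.fourierInv_fourier_eq _

/-- The Gaussian is a fixed vector of `𝓕` viewed as a unit of `End 𝓢(V, ℂ)` … -/
theorem fourierUnit_gaussian : (fourierUnit V : 𝓢(V, ℂ) →L[ℂ] 𝓢(V, ℂ)) (gaussian V) = gaussian V := by
  rw [fourierUnit_apply]; exact fourier_gaussian V

/-- … hence of the Weyl generator `σ` of the two-generator model `Heis V ⋊ F⟨σ, u⟩`. -/
theorem repP_weyl_gaussian (m : ℤ) (hm : m ≠ 0) :
    (repP V m hm (SemidirectProduct.inr (FreeGroup.of PsGen.weyl)) : 𝓢(V, ℂ) →L[ℂ] 𝓢(V, ℂ))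
        (gaussian V) = gaussian V := by
  rw [repP_weyl_apply]; exact fourier_gaussian V


-- port_pkg: scope closed for this part
end Fourier
end SchwartzWeil
end HodgeCM
end
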